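import Summits.ResolutionOfSingularities.KangarooAtlas.MizutaniProjectiveRegular
import Summits.ResolutionOfSingularities.KangarooAtlas.MizutaniHypersurfaceMultiplicity
import Literature.RingTheory.HilbertSamuel.MultiplicityNoetherian
import HarnessLib

/-!
# Mizutani's conjecture — `U_m(p) = {f ∈ S_m : mult_p(Proj(S/fS)) ≥ m}` with the MULTIPLICITY, verbatim

Cell topic `Summits/ResolutionOfSingularities/KangarooAtlas` (pub-rosobs); namespace
`Summit.ResolutionOfSingularities.KangarooAtlas.Mizutani`.  Companion to the Lean transcription of the in-house
note MIZUTANI-PROOF-g59 (AI-written, AI-audited; *AI review is weaker than expert review*; not a resolution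
theorem).

This file closes the definitional dictionary of the cell (item (G3) of MIZUTANI-LEAN.md): Mizutani (Nagoya Math.
J. 52 (1973) p. 85 L21–25) defines Hironaka's graded algebra through
«`U_m(p) = {f | f ∈ S_m, mult_p(Proj(S/fS)) ≥ m}`», the MULTIPLICITY AT THE POINT `p ∈ ℙⁿ` OF THE HYPERSURFACE
`Proj(S/fS)`, i.e. the Samuel multiplicity `e(𝒪_{ℙⁿ,p}/(f))` (Matsumura §14) of the local ring of the hypersurface at
`p` (and `0` if `p` is not on it).  The res-hironaka typing file transcribes «`mult_p f ≥ m`» as `f ∈ symbPow k 𝔭 m`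
(`∃ s ∉ 𝔭, s f ∈ 𝔭^m`).  With

* `𝒪_{ℙⁿ,𝔭} = HomogeneousLocalization.AtPrime (homogeneousSubmodule (Fin (n+1)) k) 𝔭`, the germ `f/X_i^m`
  (`projGerm`, `MizutaniProjectiveOrder.lean`) and `f ∈ symbPow ↔ m ≤ ord(f/X_i^m)` (`MizutaniProjectiveOrderPoint.lean`),
* `𝒪_{ℙⁿ,𝔭}` regular (`isRegularLocalRing_projLocalRing`, `MizutaniProjectiveRegular.lean`),
* `e(A/gA) = ord_A g` in a regular local ring (`samuelMultiplicity_quotient_span_singleton`,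
  `MizutaniHypersurfaceMultiplicity.lean`; `samuelMultiplicity` = Matsumura's `e`, `Literature/…/HilbertSamuel/Multiplicity.lean`),

this file proves, for every point `𝔭` of every `ℙⁿ_k`, a variable `X_i ∉ 𝔭` and a form `f` of degree `d`:

* **`mem_symbPow_iff_le_samuelMultiplicity`** — if `f ∈ 𝔭 ∖ 0` (the hypersurface passes through the point):
  `f ∈ symbPow k 𝔭 m ↔ m ≤ e(𝒪_{ℙⁿ,𝔭}/(f/X_i^d))` — MIZUTANI'S SENTENCE, SYMBOL FOR SYMBOL;
* `mem_symbPow_iff_eq_zero_of_not_mem` — if `f ∉ 𝔭` (the point is not on the hypersurface, multiplicity `0`):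
  `f ∈ symbPow k 𝔭 m ↔ m = 0`; (the zero form lies in every `symbPow k 𝔭 m` — encloser-2's `zero_mem_symbPow`,
  `MizutaniHironakaDimension.lean` — as Mizutani's subspace `U_m(p)` must contain it);
* `samuelMultiplicity_projLocalRing` — `e(𝒪_{ℙⁿ,𝔭}) = 1` (the ambient point is smooth).

After this file NOTHING in the chain from Mizutani's Def. 1.1 / Remark 2.10 to the tree's theorems
`mizutani_lowerBound_scheme`, `mizutani_attained_scheme` (`MizutaniHironakaScheme.lean`) is a reading convention
except the identification of «multiplicity of a variety at a point» with the Samuel multiplicity of its local ring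
(Matsumura §14) — which is the definition.

References: [Mizutani1973HironakaGroupSchemes] p. 85 L21–29, Def. 1.1; [Hironaka1970NumericalCharacters] p. 154
L24–29; [Matsumura1987] §14.
-/

noncomputable section

open MvPolynomial IsLocalRing Literature.RingTheory.HilbertSamuel Literature.AlgebraicGeometry.Resolution
  Literature.AlgebraicGeometry.Resolution.HironakaScheme

attribute [local instance] MvPolynomial.gradedAlgebra

namespace Summit.ResolutionOfSingularities.KangarooAtlas.Mizutani

universe u

section ProjectiveMultiplicity

variable {k : Type u} [Field k] {n : ℕ}
  (𝔭 : Ideal (MvPolynomial (Fin (n + 1)) k)) [h𝔭 : 𝔭.IsPrime]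

/-- The germ `φ/ℓ^m` of a NONZERO form is nonzero in `𝒪_{Proj S,𝔭}` (`S` is a domain). [folklore] -/
theorem projGerm_ne_zero {ℓ : MvPolynomial (Fin (n + 1)) k} (hℓ : ℓ ∈ homogeneousSubmodule (Fin (n + 1)) k 1)
    (hℓ𝔭 : ℓ ∉ 𝔭) {m : ℕ} {φ : MvPolynomial (Fin (n + 1)) k}
    (hφ : φ ∈ homogeneousSubmodule (Fin (n + 1)) k m) (hφ0 : φ ≠ 0) :
    projGerm 𝔭 ℓ hℓ hℓ𝔭 m φ hφ ≠ 0 := by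
  intro h
  have hval := congrArg HomogeneousLocalization.val h
  rw [val_projGerm, HomogeneousLocalization.val_zero, Localization.mk_eq_mk',
    IsLocalization.mk'_eq_zero_iff] at hval
  obtain ⟨⟨s, hs⟩, hsφ⟩ := hval
  rcases mul_eq_zero.mp hsφ with h0 | h0
  · have h0' : s = 0 := h0
    exact hs (by rw [h0']; exact 𝔭.zero_mem)
  · exact hφ0 h0

/-- **`e(𝒪_{ℙⁿ,𝔭}) = 1`**: the local ring of projective space at any point has multiplicity one (it is regular,
`isRegularLocalRing_projLocalRing`; Matsumura §14). [cite: Matsumura1987, §14 (e(A) = 1 for a regular local ring A)] -/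
theorem samuelMultiplicity_projLocalRing (hP : IsPoint k 𝔭) :
    samuelMultiplicity (HomogeneousLocalization.AtPrime (homogeneousSubmodule (Fin (n + 1)) k) 𝔭) = 1 := by
  haveI := isRegularLocalRing_projLocalRing 𝔭 hP
  exact samuelMultiplicity_of_isRegularLocalRing

/-- The local ring `𝒪_{ℙⁿ,𝔭}/(f/X_i^d)` of the hypersurface `f = 0` at a point `𝔭` lying on it is a local ring
(use-site instance for `mem_symbPow_iff_le_samuelMultiplicity`). [folklore] -/
theorem isLocalRing_projLocalRing_quotient (hP : IsPoint k 𝔭) {i : Fin (n + 1)}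
    (hi : (X i : MvPolynomial (Fin (n + 1)) k) ∉ 𝔭) {d : ℕ} {φ : MvPolynomial (Fin (n + 1)) k}
    (hφ : φ ∈ homogeneousSubmodule (Fin (n + 1)) k d) (hφ𝔭 : φ ∈ 𝔭) :
    IsLocalRing (HomogeneousLocalization.AtPrime (homogeneousSubmodule (Fin (n + 1)) k) 𝔭 ⧸
      Ideal.span {projGerm 𝔭 (X i) (Literature.AlgebraicGeometry.Motives.ProjectiveSpace.X_mem i) hi d φ hφ}) := by
  haveI := isRegularLocalRing_projLocalRing 𝔭 hP
  exact isLocalRing_quotient_span_singleton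
    ((projGerm_mem_maximalIdeal_iff (Literature.AlgebraicGeometry.Motives.ProjectiveSpace.X_mem i) hi d φ hφ).mpr hφ𝔭)

/-- **MIZUTANI'S `U_m(p) = {f ∈ S_m : mult_p(Proj(S/fS)) ≥ m}` VERBATIM** (Nagoya Math. J. 52 p. 85 L23–25), for the
forms through the point: for a point `𝔭` of `ℙⁿ_k`, a variable `X_i ∉ 𝔭`, and a NONZERO form `f` of degree `d`
with `f ∈ 𝔭` (the hypersurface `Proj(S/fS)` passes through `𝔭`), the res-hironaka transcription
`f ∈ symbPow k 𝔭 m` («`∃ s ∉ 𝔭, s·f ∈ 𝔭^m`», used in `multGens`/`multAlgebra`/`bIdeal`, i.e. in `B_{P,𝔭}`) holds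
iff **`m ≤ e(𝒪_{ℙⁿ,𝔭}/(f/X_i^d))`**, the Samuel MULTIPLICITY (Matsumura §14, tree `samuelMultiplicity`) of the
local ring at `𝔭` of the hypersurface — because `𝒪_{ℙⁿ,𝔭}` is a regular local ring, in which the multiplicity of a
hypersurface is the order of its local equation (`samuelMultiplicity_quotient_span_singleton`), and the order
reading is `mem_symbPow_iff_le_adicOrder_projGerm` (the variable `X_i` is a linear form: the tree's
`Literature.AlgebraicGeometry.Motives.ProjectiveSpace.X_mem`).  (The quotient is a local ring:
`isLocalRing_projLocalRing_quotient`; the instance is a hypothesis only for typing reasons.)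
[cite: Mizutani1973HironakaGroupSchemes, p. 85 L21–25 (U(p), U_m(p) = {f ∈ S_m : mult_p(Proj(S/fS)) ≥ m}); Matsumura1987, §14 (multiplicity)] -/
theorem mem_symbPow_iff_le_samuelMultiplicity (hP : IsPoint k 𝔭) {i : Fin (n + 1)}
    (hi : (X i : MvPolynomial (Fin (n + 1)) k) ∉ 𝔭) {d : ℕ} (φ : MvPolynomial (Fin (n + 1)) k)
    (hφ : φ ∈ homogeneousSubmodule (Fin (n + 1)) k d) (hφ𝔭 : φ ∈ 𝔭) (hφ0 : φ ≠ 0)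
    [IsLocalRing (HomogeneousLocalization.AtPrime (homogeneousSubmodule (Fin (n + 1)) k) 𝔭 ⧸
      Ideal.span {projGerm 𝔭 (X i) (Literature.AlgebraicGeometry.Motives.ProjectiveSpace.X_mem i) hi d φ hφ})] (m : ℕ) :
    φ ∈ symbPow k 𝔭 m ↔
      m ≤ samuelMultiplicity
        (HomogeneousLocalization.AtPrime (homogeneousSubmodule (Fin (n + 1)) k) 𝔭 ⧸
          Ideal.span {projGerm 𝔭 (X i) (Literature.AlgebraicGeometry.Motives.ProjectiveSpace.X_mem i) hi d φ hφ}) := by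
  haveI := isRegularLocalRing_projLocalRing 𝔭 hP
  have hg : projGerm 𝔭 (X i) (Literature.AlgebraicGeometry.Motives.ProjectiveSpace.X_mem i) hi d φ hφ ∈
      maximalIdeal (HomogeneousLocalization.AtPrime (homogeneousSubmodule (Fin (n + 1)) k) 𝔭) :=
    (projGerm_mem_maximalIdeal_iff (Literature.AlgebraicGeometry.Motives.ProjectiveSpace.X_mem i) hi d φ hφ).mpr hφ𝔭
  have hg0 := projGerm_ne_zero 𝔭 (Literature.AlgebraicGeometry.Motives.ProjectiveSpace.X_mem i) hi hφ hφ0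
  refine (mem_symbPow_iff_le_adicOrder_projGerm (Literature.AlgebraicGeometry.Motives.ProjectiveSpace.X_mem i) hi
    (isHomogeneous_of_isPoint 𝔭 hP) φ hφ m).trans ?_
  rw [← samuelMultiplicity_quotient_span_singleton hg hg0, Nat.cast_le]

omit h𝔭 in
/-- The complementary case **`p ∉ Proj(S/fS)`** (multiplicity `0`): for a prime `𝔭` and a form (indeed any `f`)
with `f ∉ 𝔭`, `f ∈ symbPow k 𝔭 m ↔ m = 0`. [cite: Mizutani1973HironakaGroupSchemes, p. 85 L21–25 (U_0(p) = S_0; U_m(p) for m ≥ 1)] -/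
theorem mem_symbPow_iff_eq_zero_of_not_mem [h𝔭' : 𝔭.IsPrime] {f : MvPolynomial (Fin (n + 1)) k} (hf : f ∉ 𝔭)
    (m : ℕ) : f ∈ symbPow k 𝔭 m ↔ m = 0 := by
  constructor
  · rintro ⟨s, hs, hsf⟩
    by_contra hm
    have h1 : s * f ∈ 𝔭 := Ideal.pow_le_self hm hsf
    exact (h𝔭'.mem_or_mem h1).elim hs hf
  · rintro rfl
    exact mem_symbPow_zero h𝔭'.ne_top f

end ProjectiveMultiplicity

/-! ### Change of chart: the multiplicity does not depend on the variable `X_i ∉ 𝔭` -/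

section ChartIndependence

variable {k : Type u} [Field k] {n : ℕ}
  (𝔭 : Ideal (MvPolynomial (Fin (n + 1)) k)) [h𝔭 : 𝔭.IsPrime]

/-- In `𝒪_{Proj S,𝔭}`: `φ/X_i^d = (φ/X_j^d) · (X_j^d/X_i^d)` for two variables off `𝔭`. [folklore] -/
theorem projGerm_X_eq_mul {i j : Fin (n + 1)} (hi : (X i : MvPolynomial (Fin (n + 1)) k) ∉ 𝔭)
    (hj : (X j : MvPolynomial (Fin (n + 1)) k) ∉ 𝔭) {d : ℕ} (φ : MvPolynomial (Fin (n + 1)) k)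
    (hφ : φ ∈ homogeneousSubmodule (Fin (n + 1)) k d) :
    projGerm 𝔭 (X i) (Literature.AlgebraicGeometry.Motives.ProjectiveSpace.X_mem i) hi d φ hφ =
      projGerm 𝔭 (X j) (Literature.AlgebraicGeometry.Motives.ProjectiveSpace.X_mem j) hj d φ hφ *
        projGerm 𝔭 (X i) (Literature.AlgebraicGeometry.Motives.ProjectiveSpace.X_mem i) hi d
          ((X j : MvPolynomial (Fin (n + 1)) k) ^ d)
          (pow_mem_homogeneousSubmodule_of_mem_one (Literature.AlgebraicGeometry.Motives.ProjectiveSpace.X_mem j) d) := by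
  rw [HomogeneousLocalization.ext_iff_val, HomogeneousLocalization.val_mul, val_projGerm, val_projGerm, val_projGerm,
    Localization.mk_mul]
  refine Localization.mk_eq_mk_iff.mpr (Localization.r_of_eq ?_)
  simp only [Submonoid.coe_mul]
  ring

/-- **The ideal `(φ/X_i^d) ⊂ 𝒪_{Proj S,𝔭}` of the hypersurface germ does not depend on the chart**: for `X_i, X_j ∉ 𝔭`,
`(φ/X_i^d) = (φ/X_j^d)` as ideals (the two germs differ by the unit `(X_j/X_i)^d`). [folklore] -/
theorem span_projGerm_X_eq {i j : Fin (n + 1)} (hi : (X i : MvPolynomial (Fin (n + 1)) k) ∉ 𝔭)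
    (hj : (X j : MvPolynomial (Fin (n + 1)) k) ∉ 𝔭) {d : ℕ} (φ : MvPolynomial (Fin (n + 1)) k)
    (hφ : φ ∈ homogeneousSubmodule (Fin (n + 1)) k d) :
    Ideal.span {projGerm 𝔭 (X i) (Literature.AlgebraicGeometry.Motives.ProjectiveSpace.X_mem i) hi d φ hφ} =
      Ideal.span {projGerm 𝔭 (X j) (Literature.AlgebraicGeometry.Motives.ProjectiveSpace.X_mem j) hj d φ hφ} := by
  rw [projGerm_X_eq_mul 𝔭 hi hj φ hφ]
  refine Ideal.span_singleton_mul_right_unit ?_ _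
  rw [isUnit_projGerm_iff]
  exact pow_not_mem_of_not_mem hj d

/-- Hence **the multiplicity `e(𝒪_{ℙⁿ,𝔭}/(φ/X_i^d))` in `mem_symbPow_iff_le_samuelMultiplicity` is independent of the chosen
variable** `X_i ∉ 𝔭` (the two quotient rings are isomorphic local rings; Noetherian as quotients of the Noetherian `𝒪_{ℙⁿ,𝔭}`).
[cite: Mizutani1973HironakaGroupSchemes, p. 85 L23–25 (mult_p(Proj(S/fS)) is intrinsic); Matsumura1987, §14] -/
theorem samuelMultiplicity_quotient_projGerm_X_eq (hP : IsPoint k 𝔭) {i j : Fin (n + 1)}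
    (hi : (X i : MvPolynomial (Fin (n + 1)) k) ∉ 𝔭) (hj : (X j : MvPolynomial (Fin (n + 1)) k) ∉ 𝔭) {d : ℕ}
    (φ : MvPolynomial (Fin (n + 1)) k) (hφ : φ ∈ homogeneousSubmodule (Fin (n + 1)) k d)
    [IsLocalRing (HomogeneousLocalization.AtPrime (homogeneousSubmodule (Fin (n + 1)) k) 𝔭 ⧸
      Ideal.span {projGerm 𝔭 (X i) (Literature.AlgebraicGeometry.Motives.ProjectiveSpace.X_mem i) hi d φ hφ})]
    [IsLocalRing (HomogeneousLocalization.AtPrime (homogeneousSubmodule (Fin (n + 1)) k) 𝔭 ⧸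
      Ideal.span {projGerm 𝔭 (X j) (Literature.AlgebraicGeometry.Motives.ProjectiveSpace.X_mem j) hj d φ hφ})] :
    samuelMultiplicity (HomogeneousLocalization.AtPrime (homogeneousSubmodule (Fin (n + 1)) k) 𝔭 ⧸
        Ideal.span {projGerm 𝔭 (X i) (Literature.AlgebraicGeometry.Motives.ProjectiveSpace.X_mem i) hi d φ hφ}) =
      samuelMultiplicity (HomogeneousLocalization.AtPrime (homogeneousSubmodule (Fin (n + 1)) k) 𝔭 ⧸
        Ideal.span {projGerm 𝔭 (X j) (Literature.AlgebraicGeometry.Motives.ProjectiveSpace.X_mem j) hj d φ hφ}) := by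
  haveI := isRegularLocalRing_projLocalRing 𝔭 hP
  exact samuelMultiplicity_eq_of_ringEquiv (Ideal.quotEquivOfEq (span_projGerm_X_eq 𝔭 hi hj φ hφ))

/-- **«mult = ν» at a point of `ℙⁿ`**: for a point `𝔭`, `X_i ∉ 𝔭` and a nonzero form `φ ∈ 𝔭` of degree `d`, the Samuel
multiplicity of the local ring `𝒪_{ℙⁿ,𝔭}/(φ/X_i^d)` of the hypersurface `φ = 0` at `𝔭` (Mizutani's `mult_p(Proj(S/φS))`) equals
Hironaka's order `ν_𝔭(φ/X_i^d)` (Kyoto 1970 p. 154) — the two printed definitions of `U(𝔭)` name the same numbers.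
[cite: Mizutani1973HironakaGroupSchemes, p. 85 L23–25; Hironaka1970NumericalCharacters, p. 154 L24–29; Matsumura1987, §14] -/
theorem samuelMultiplicity_quotient_projGerm_eq_adicOrder (hP : IsPoint k 𝔭) {i : Fin (n + 1)}
    (hi : (X i : MvPolynomial (Fin (n + 1)) k) ∉ 𝔭) {d : ℕ} (φ : MvPolynomial (Fin (n + 1)) k)
    (hφ : φ ∈ homogeneousSubmodule (Fin (n + 1)) k d) (hφ𝔭 : φ ∈ 𝔭) (hφ0 : φ ≠ 0)
    [IsLocalRing (HomogeneousLocalization.AtPrime (homogeneousSubmodule (Fin (n + 1)) k) 𝔭 ⧸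
      Ideal.span {projGerm 𝔭 (X i) (Literature.AlgebraicGeometry.Motives.ProjectiveSpace.X_mem i) hi d φ hφ})] :
    (samuelMultiplicity (HomogeneousLocalization.AtPrime (homogeneousSubmodule (Fin (n + 1)) k) 𝔭 ⧸
        Ideal.span {projGerm 𝔭 (X i) (Literature.AlgebraicGeometry.Motives.ProjectiveSpace.X_mem i) hi d φ hφ}) : ℕ∞) =
      adicOrder (projGerm 𝔭 (X i) (Literature.AlgebraicGeometry.Motives.ProjectiveSpace.X_mem i) hi d φ hφ) := by
  haveI := isRegularLocalRing_projLocalRing 𝔭 hP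
  exact samuelMultiplicity_quotient_span_singleton
    ((projGerm_mem_maximalIdeal_iff (Literature.AlgebraicGeometry.Motives.ProjectiveSpace.X_mem i) hi d φ hφ).mpr hφ𝔭)
    (projGerm_ne_zero 𝔭 (Literature.AlgebraicGeometry.Motives.ProjectiveSpace.X_mem i) hi hφ hφ0)

end ChartIndependence

end Summit.ResolutionOfSingularities.KangarooAtlas.Mizutani

end
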